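import Summits.CriticalPhenomena.Ising3D.TaylorRegionDeltaCapstone
import Mathlib.Tactic.Linarith
import Mathlib.Tactic.Positivity
import Mathlib.Tactic.Ring
import HarnessLib

/-!
# Literal-table helpers for the wide-box region certificates (shared by the even and odd literal-table files)
(cell `pub-ising3x`, seat recog-1 gen 13; gate (g2))

HONEST FRAMING: lottery ticket; floor = tightest certified 3D Ising CFT bounds; no exact-solution
claim without a proof. Island framing: certified exclusion region at stated derivative order and
assumptions; not a determination of the 3D Ising critical exponents beyond that.

Small generic pieces used by `TaylorRegionDeltaLitEven` / `TaylorRegionDeltaLitOdd`: tuple projections, `PMem2` from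
row-wise memberships, the moment substitution ROW BY ROW on a literal `(P, D)` table (`substMomRowI`,
`pmem2_substMom_of_rows` — so that the `(E, θ)` tail tables can be certified one power of `θ` per kernel declaration),
the θ-cell form `hsCell` of `halfStripPos2`, literal δ-table triples (`ITab3`, `tabOK`, `tripL`, `pmem3_tripL`) and the
piece count `numPieces` of producer breakpoints. Elementary. [folklore]
-/

namespace Summit.CriticalPhenomena.Ising3D

open Finset Set
open Literature.Analysis.ValidatedNumerics Literature.Analysis.ValidatedNumerics.PolyMP
open Literature.Analysis.ValidatedNumerics.NumericsMP (MI)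
open Literature.MathematicalPhysics.QuantumFieldTheory.ConformalBootstrap3D

/-! ### Generic helpers: 4-tuples, `PMem2` from rows -/

/-- Component `c` of a 4-tuple (`c ≥ 3` ↦ the last). [folklore] -/
def proj4 {α : Type*} (T : α × α × α × α) : ℕ → α
  | 0 => T.1
  | 1 => T.2.1
  | 2 => T.2.2.1
  | _ => T.2.2.2

/-- `PMem2` from equal lengths and row-wise memberships. [folklore] -/
theorem pmem2_of_getD {S : ℕ} : ∀ {G : List (List ℝ)} {L : IPoly2}, G.length = L.length →
    (∀ r : ℕ, r < L.length → PMem S (G.getD r []) (L.getD r [])) → PMem2 S G L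
  | [], [], _, _ => List.Forall₂.nil
  | [], _ :: _, h, _ => by simp at h
  | _ :: _, [], h, _ => by simp at h
  | g :: G, P :: L, h, hr => by
      refine List.Forall₂.cons ?_ (pmem2_of_getD (by simpa using h) fun r hr' => ?_)
      · simpa using hr 0 (by simp)
      · simpa using hr (r + 1) (by simpa using hr')

/-- [folklore] -/
theorem length_eq_of_pmem2 {S : ℕ} {G : List (List ℝ)} {L : IPoly2} (h : PMem2 S G L) : G.length = L.length :=
  List.Forall₂.length_eq h

/-! ### The `(E, θ)` tail tables from a literal `(P, D)` table, row by row -/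

/-- Row `r` (power of `θ`) of the moment substitution applied to a (literal) `(P, D)` table. [folklore] -/
def substMomRowI (S : ℕ) (QI : IPoly2) (cc : ℚ) (N r : ℕ) : IPoly :=
  sumI (fun k => smulQI (momCoeff k r) (mulI S (QI.getD (2 * k) []) (powShiftI S cc r))) N

/-- [folklore] -/
theorem substMomI_getD (S : ℕ) (QI : IPoly2) (cc : ℚ) (N R r : ℕ) (hr : r < R) :
    (substMomI S QI cc N R).getD r [] = substMomRowI S QI cc N r := by
  rw [substMomI, List.getD_eq_getElem?_getD, List.getElem?_map, List.getElem?_range hr]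
  rfl

/-- [folklore] -/
theorem length_substMomI (S : ℕ) (QI : IPoly2) (cc : ℚ) (N R : ℕ) : (substMomI S QI cc N R).length = R := by
  simp [substMomI]

/-- **Tail table through literals**: from `PMem2 S Q LPD` (the `(P, D)` table in a literal) and row-wise containment of
the moment substitution of the LITERAL in `LT`, `PMem2 S (substMom Q cc N R) LT`. [folklore] -/
theorem pmem2_substMom_of_rows {S : ℕ} (hS : 0 < S) {Q : List (List ℝ)} {LPD LT : IPoly2} (hQ : PMem2 S Q LPD)
    (cc : ℚ) (N R : ℕ) (hlen : LT.length = R)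
    (hrows : ∀ r : ℕ, r < R → subsetI (substMomRowI S LPD cc N r) (LT.getD r []) = true) :
    PMem2 S (substMom Q (cc : ℝ) N R) LT := by
  have hP := pmem2_substMomI hS hQ cc N R
  refine pmem2_of_getD (by rw [(length_eq_of_pmem2 hP), length_substMomI, hlen]) fun r hr => ?_
  rw [hlen] at hr
  have h1 := pmem_getD_of_pmem2 hP r
  rw [substMomI_getD S LPD cc N R r hr] at h1
  exact pmem_of_subsetI h1 (hrows r hr)

/-- The `k`-th θ-cell test of `halfStripPos2 S H P0 prm`. [folklore] -/
def hsCell (S : ℕ) (H : IPoly2) (P0 : ℚ) (prm : HSParams) (k : ℕ) : Bool :=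
  cellOK S H (effCols H (rowMax2I H)) P0 prm.P1 (prm.θhi * (2 * (k : ℚ) + 1) / (2 * (prm.nθ : ℚ)))
    (prm.θhi / (2 * (prm.nθ : ℚ))) prm.dP

/-- `halfStripPos2` from its θ-cells (`hsCell` form). [folklore] -/
theorem halfStripPos2_of_hsCells {S : ℕ} {H : IPoly2} {P0 : ℚ} {prm : HSParams} (hθ : 0 < prm.θhi)
    (hn : 0 < prm.nθ) (h : ∀ k : ℕ, k < prm.nθ → hsCell S H P0 prm k = true) : halfStripPos2 S H P0 prm = true := by
  simp only [halfStripPos2, Bool.and_eq_true, decide_eq_true_eq, List.all_eq_true, List.mem_range]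
  exact ⟨⟨hθ, hn⟩, h⟩

/-! ### Literal δ-tables and rows from them -/

/-- Literal δ-tables `(T₀, T₁, T₂)` of one component. [folklore] -/
abbrev ITab3 := IPoly2 × IPoly2 × IPoly2

/-- Containment of the computed δ-table of order `m` (`0, 1, ≥ 2 ↦ 2`) in the literal — ONE declaration each
(1 / 2 / 6 kernel table builds). [folklore] -/
def tabOK (S : ℕ) (c : ℕ × ℕ → ℚ) (σQ s₀ W cc : ℚ) (l : List (ℕ × ℕ)) (T : ITab3) : ℕ → Bool
  | 0 => subset2I (deltaT0 S c σQ s₀ cc l) T.1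
  | 1 => subset2I (deltaT1 S c σQ s₀ cc l) T.2.1
  | _ => subset2I (deltaT2 S c σQ s₀ W cc l) T.2.2

/-- The row triple of row `j` computed from LITERAL tables (cheap). [folklore] -/
def tripL (T : ITab3) (N j : ℕ) : ITriple := (qRowOfTableI T.1 N j, qRowOfTableI T.2.1 N j, qRowOfTableI T.2.2 N j)

/-- [folklore] -/
theorem pmem3_tripL {S : ℕ} (hS : 0 < S) (c : ℕ × ℕ → ℚ) (σQ s₀ : ℚ) {W : ℚ} (hW : 0 ≤ W) (cc : ℚ) (l : List (ℕ × ℕ))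
    {T : ITab3} (hT : ∀ m : ℕ, m < 3 → tabOK S c σQ s₀ W cc l T m = true) (N j : ℕ) {δ : ℝ} (hδ : |δ| ≤ W) :
    PMem3 S (qRowOfTable (deltaT0R c σQ s₀ cc l) N j, qRowOfTable (deltaT1R c σQ s₀ cc l) N j,
        qRowOfTable (deltaT2R c σQ s₀ cc l δ) N j) (tripL T N j) := by
  have h0 : subset2I (deltaT0 S c σQ s₀ cc l) T.1 = true := hT 0 (by norm_num)
  have h1 : subset2I (deltaT1 S c σQ s₀ cc l) T.2.1 = true := hT 1 (by norm_num)
  have h2 : subset2I (deltaT2 S c σQ s₀ W cc l) T.2.2 = true := hT 2 (by norm_num)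
  exact ⟨pmem_qRowOfTableI (pmem2_of_subset2I (pmem2_deltaT0 hS c σQ s₀ cc l) h0) N j,
    pmem_qRowOfTableI (pmem2_of_subset2I (pmem2_deltaT1 hS c σQ s₀ cc l) h1) N j,
    pmem_qRowOfTableI (pmem2_of_subset2I (pmem2_deltaT2 hS c σQ s₀ hW cc l hδ) h2) N j⟩

/-- Number of pieces of row `j` under producer breakpoints `B` (`|B[j]| + 1`). [folklore] -/
def numPieces (B : List (List ℚ)) (j : ℕ) : ℕ := (B.getD j []).length + 1

/-- [folklore] -/
theorem numPieces_pos (B : List (List ℚ)) (j : ℕ) : 0 < numPieces B j := Nat.succ_pos _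

/-- Component `c` of a 5-tuple (`c ≥ 4` ↦ the last). [folklore] -/
def proj5 {α : Type*} (T : α × α × α × α × α) : ℕ → α
  | 0 => T.1
  | 1 => T.2.1
  | 2 => T.2.2.1
  | 3 => T.2.2.2.1
  | _ => T.2.2.2.2

/-- Literal table 5-tuples. [folklore] -/
abbrev IPoly2x5 := IPoly2 × IPoly2 × IPoly2 × IPoly2 × IPoly2
/-- [folklore] -/
abbrev ITab3x5 := ITab3 × ITab3 × ITab3 × ITab3 × ITab3

end Summit.CriticalPhenomena.Ising3D
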